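import Literature.Geometry.Lorentzian.CoordBochner
import Literature.Geometry.Lorentzian.CoordCurvatureNormSq
import HarnessLib

/-!
# Surfaces in coordinates: `Ric = ½ S g` and the Bochner identity behind Gauss–Bonnet

A two-dimensional layer of the coordinate tensor calculus (`CoordCurvature`, `CoordBochner`):
metric components `G : E → (E →L E →L ℝ)`, smooth, symmetric and nondegenerate on an open set
`V` (`IsMetricOn G V`), positive definite at the point `x`, with `dim E = 2`. We prove

* `ricAt_eq_half_scalAt_mul` — **on a surface the Ricci tensor is `½ S g`** (`Ric = K g`,
  `S = 2K`; O'Neill 1983, Ch. 3, Lemma 3.52 and Def. 3.53 read in dimension two, where the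
  curvature tensor is `K (g ∧ g)`), from the symmetries of the curvature tensor in a
  `G_x`-orthonormal basis;
* `normSqAt_hessian_identity_two` — the Cayley–Hamilton identity
  `|β|² g(v,v) − 2 β(♯β(v,·), v) + 2 (tr β) β(v,v) − (tr β)² g(v,v) = 0` for a symmetric form
  `β` on a `2`-dimensional space (`tr A² = (tr A)² − 2 det A`, `A² = (tr A) A − (det A) 1` for
  `A = ♯β`);
* `half_scalAt_mul_gradSqAt_sq` — **the identity behind the transgression of the Gauss–Bonnet
  integrand**: for `f` smooth on `V`, `u = |∇f|²`, `L = Δf`,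

    `½ S u² = ½ u Δu − ½ ⟨∇u, ∇u⟩ − u ⟨∇L, ∇f⟩ + L ⟨∇u, ∇f⟩ − L² u`   at `x`,

  i.e. `K = div (∇_e e − (div e) e)`, `e = ∇f/|∇f|`, multiplied out (no division): the Bochner
  formula `Δ|∇f|² = 2|Hess f|² + 2⟨∇f, ∇Δf⟩ + 2 Ric(∇f,∇f)` (the tree's
  `IsMetricOn.lapAt_gradSqAt`; Topping 2006, proof of Prop. 8.2.6) with
  `Ric(∇f,∇f) = ½ S |∇f|²` and the Cayley–Hamilton identity.

This is the pointwise computation of the classical intrinsic proof of the Gauss–Bonnet theorem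
(the curvature form is exact away from the zeros of a vector field: `K dA = dω₁₂` for the frame
`e₁ = ∇f/|∇f|`; Chern 1944, §1–§2), written with functions only so that Green's
identity integrates it. Everything is proved; no definitions, no named facts.

## References

* B. O'Neill, *Semi-Riemannian geometry with applications to relativity*, Academic Press 1983,
  Ch. 3, Prop. 3.36, Lemma 3.52, Def. 3.53. [ONeill1983]
* P. Topping, *Lectures on the Ricci flow*, LMS Lecture Note Series 325, CUP 2006, proof of
  Prop. 8.2.6 (Bochner formula). [Topping2006]
* S.-S. Chern, *A simple intrinsic proof of the Gauss–Bonnet formula for closed Riemannian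
  manifolds*, Ann. of Math. 45 (1944) 747–752, §1–§2 (the curvature form is exact on the unit
  sphere bundle: `Ω = dΠ`; for surfaces `K dA = dω₁₂`). [Chern1944]
-/

noncomputable section

open Set Filter ContinuousLinearMap Module
open scoped Topology ContDiff

namespace Literature.Geometry.Lorentzian

namespace MetricCoord

variable {E : Type*} [NormedAddCommGroup E] [NormedSpace ℝ E] [FiniteDimensional ℝ E]
  {G : E → E →L[ℝ] E →L[ℝ] ℝ} {V : Set E} {x : E}

/-! ### Linear algebra in an orthonormal basis of a two-dimensional fibre -/

section Orthonormal

variable (e : Basis (Fin 2) ℝ E) (he : ∀ i j, G x (e i) (e j) = if i = j then 1 else 0)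
include he

omit [FiniteDimensional ℝ E] in
/-- `♯α = Σ_m α(e_m) e_m` in an orthonormal basis. [cite: ONeill1983, Ch. 3, p. 60] -/
theorem sharpAt_eq_sum_of_orthonormal (hi : (G x).IsInvertible)
    (hs : ∀ v w : E, G x v w = G x w v) (α : E →L[ℝ] ℝ) :
    sharpAt G x α = ∑ m, α (e m) • e m := by
  refine sharpAt_eq_of_forall hi fun w ↦ ?_
  rw [map_sum, _root_.sum_apply]
  conv_rhs => rw [← sum_apply_smul_of_orthonormal e he w, map_sum]
  refine Finset.sum_congr rfl fun m _ ↦ ?_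
  rw [map_smul, _root_.smul_apply, smul_eq_mul, map_smul, smul_eq_mul, hs (e m) w,
    mul_comm]

/-- **On a surface `Ric = K g`**, `K = g(R(e₀,e₁)e₁, e₀)` in an orthonormal basis: expand in the
basis and use the skew-symmetries of the curvature tensor (O'Neill 1983, Ch. 3, Prop. 3.36,
Lemma 3.52). [cite: ONeill1983, Ch. 3, Prop. 3.36 and Lemma 3.52] -/
theorem ricAt_eq_sectional_mul [CompleteSpace E] (hG : IsMetricOn G V) (hx : x ∈ V) (Y Z : E) :
    ricAt G x Y Z = G x (riemAt G x (e 0) (e 1) (e 1)) (e 0) * G x Y Z := by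
  classical
  have hi := hG.isInvertible x hx
  have hs := hG.symm x hx
  -- vanishing of `g(R(X,Y)W, W)` and the value of `g(R(e₁,e₀)e₀, e₁)`
  have hWW : ∀ X Y' W : E, G x (riemAt G x X Y' W) W = 0 := fun X Y' W ↦ by
    have h := hG.apply_riemAt_swap hx X Y' W W
    linarith
  have h1001 : G x (riemAt G x (e 1) (e 0) (e 0)) (e 1) =
      G x (riemAt G x (e 0) (e 1) (e 1)) (e 0) := by
    rw [riemAt_swap, _root_.neg_apply, map_neg, _root_.neg_apply,
      hG.apply_riemAt_swap hx (e 0) (e 1) (e 1) (e 0), neg_neg]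
  set Kc := G x (riemAt G x (e 0) (e 1) (e 1)) (e 0) with hKc
  -- the coordinates of `Y`, `Z`
  set Y0 := G x Y (e 0)
  set Y1 := G x Y (e 1)
  set Z0 := G x Z (e 0)
  set Z1 := G x Z (e 1)
  have hY : Y0 • e 0 + Y1 • e 1 = Y := by
    have h := sum_apply_smul_of_orthonormal e he Y
    simpa [Fin.sum_univ_two] using h
  have hZ : Z0 • e 0 + Z1 • e 1 = Z := by
    have h := sum_apply_smul_of_orthonormal e he Z
    simpa [Fin.sum_univ_two] using h
  have hYZ : G x Y Z = Y0 * Z0 + Y1 * Z1 := by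
    rw [apply_eq_sum_of_orthonormal e he hs Y Z]
    simp [Fin.sum_univ_two, Y0, Y1, Z0, Z1]
  rw [ricAt_eq_sum_ginv e hi]
  simp only [ginv_of_orthonormal e he hi, Fin.sum_univ_two, if_true, one_mul,
    show ((0 : Fin 2) = 1) = False from by simp, show ((1 : Fin 2) = 0) = False from by simp,
    if_false, zero_mul, add_zero, zero_add]
  conv_lhs => rw [← hY, ← hZ]
  simp only [riemAt_add_right, riemAt_smul_right, riemAt_self, map_add, map_smul,
    _root_.add_apply, _root_.smul_apply, smul_eq_mul, hWW, h1001, mul_zero, zero_add, add_zero,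
    smul_zero]
  rw [hYZ]
  ring

/-- **On a surface `S = 2K`**: the scalar curvature is twice the sectional curvature
`g(R(e₀,e₁)e₁, e₀)` of an orthonormal basis (O'Neill 1983, Ch. 3, Def. 3.53).
[cite: ONeill1983, Ch. 3, Def. 3.53] -/
theorem scalAt_eq_two_mul_sectional [CompleteSpace E] (hG : IsMetricOn G V) (hx : x ∈ V) :
    scalAt G x = 2 * G x (riemAt G x (e 0) (e 1) (e 1)) (e 0) := by
  classical
  have hi := hG.isInvertible x hx
  rw [scalAt_eq_sum e]
  simp only [ginv_of_orthonormal e he hi, Fin.sum_univ_two, if_true, one_mul,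
    show ((0 : Fin 2) = 1) = False from by simp, show ((1 : Fin 2) = 0) = False from by simp,
    if_false, zero_mul, add_zero, zero_add, ricAt_eq_sectional_mul e he hG hx]
  have h00 : G x (e 0) (e 0) = 1 := by simpa using he 0 0
  have h11 : G x (e 1) (e 1) = 1 := by simpa using he 1 1
  rw [h00, h11]
  ring

/-- **The Cayley–Hamilton identity for a symmetric form on a `2`-dimensional fibre**:
`|β|² g(v,v) − 2 β(♯β(v,·), v) + 2 (tr_g β) β(v,v) − (tr_g β)² g(v,v) = 0`
(`A = ♯β` is `g`-self-adjoint, `tr A² = (tr A)² − 2 det A`, `A² = (tr A) A − (det A) 1`), by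
expansion in an orthonormal basis. [folklore] -/
theorem normSqAt_identity_two [CompleteSpace E] (hG : IsMetricOn G V) (hx : x ∈ V)
    {β : E →L[ℝ] E →L[ℝ] ℝ} (hβ : ∀ v w, β v w = β w v) (v : E) :
    normSqAt G x β * G x v v - 2 * β (sharpAt G x (β v)) v
      + 2 * mtrAt G x β * β v v - mtrAt G x β ^ 2 * G x v v = 0 := by
  classical
  have hi := hG.isInvertible x hx
  have hs := hG.symm x hx
  set v0 := G x v (e 0)
  set v1 := G x v (e 1)
  have hv : v0 • e 0 + v1 • e 1 = v := by
    have h := sum_apply_smul_of_orthonormal e he v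
    simpa [Fin.sum_univ_two] using h
  have hvv : G x v v = v0 * v0 + v1 * v1 := by
    rw [apply_eq_sum_of_orthonormal e he hs v v]
    simp [Fin.sum_univ_two, v0, v1]
  have h10 : β (e 1) (e 0) = β (e 0) (e 1) := hβ _ _
  rw [hG.normSqAt_eq_sum_of_symm e hx hβ, mtrAt_eq_sum e, hvv]
  simp only [ginv_of_orthonormal e he hi, Fin.sum_univ_two, if_true, one_mul,
    show ((0 : Fin 2) = 1) = False from by simp, show ((1 : Fin 2) = 0) = False from by simp,
    if_false, zero_mul, add_zero, zero_add, sharpAt_eq_sum_of_orthonormal e he hi hs]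
  conv_lhs => rw [← hv]
  simp only [map_add, map_smul, _root_.add_apply, _root_.smul_apply,
    smul_eq_mul, h10]
  ring

end Orthonormal

/-! ### Surfaces: `Ric = ½ S g` and the Bochner identity multiplied out -/

section Surface

variable [CompleteSpace E]

omit [CompleteSpace E] in
/-- An orthonormal basis indexed by `Fin 2` of a positive definite `2`-dimensional fibre.
[cite: ONeill1983, Ch. 2, Lemma 2.24] -/
theorem exists_orthonormal_basis_two (hs : ∀ v w, G x v w = G x w v)
    (hpos : ∀ v, v ≠ 0 → 0 < G x v v) (h2 : finrank ℝ E = 2) :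
    ∃ e : Basis (Fin 2) ℝ E, ∀ i j, G x (e i) (e j) = if i = j then 1 else 0 := by
  obtain ⟨e, he⟩ := exists_orthonormal_basis hs hpos
  refine ⟨e.reindex (finCongr h2), fun i j ↦ ?_⟩
  rw [Basis.reindex_apply, Basis.reindex_apply, he]
  simp [finCongr, Fin.ext_iff]

/-- **On a surface the Ricci tensor is half the scalar curvature times the metric**:
`Ric_x(Y, Z) = ½ S(x) g_x(Y, Z)` for positive definite two-dimensional metric components
(O'Neill 1983, Ch. 3, Lemma 3.52 / Def. 3.53 in dimension `2`: `Ric = K g`, `S = 2K`).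
[cite: ONeill1983, Ch. 3, Lemma 3.52 and Def. 3.53] -/
theorem ricAt_eq_half_scalAt_mul (hG : IsMetricOn G V) (hx : x ∈ V)
    (hpos : ∀ v, v ≠ 0 → 0 < G x v v) (h2 : finrank ℝ E = 2) (Y Z : E) :
    ricAt G x Y Z = scalAt G x / 2 * G x Y Z := by
  obtain ⟨e, he⟩ := exists_orthonormal_basis_two (hG.symm x hx) hpos h2
  rw [ricAt_eq_sectional_mul e he hG hx, scalAt_eq_two_mul_sectional e he hG hx]
  ring

/-- **The transgression identity of the Gauss–Bonnet integrand, multiplied out.** For metric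
components `G` positive definite at `x ∈ V` with `dim E = 2` and `f` smooth on `V`, writing
`u = |∇f|²_G`, `L = Δ_G f`, `♯` for index raising and `S` for the scalar curvature,

  `½ S(x) u(x)² = ½ u Δu − ½ Du(♯Du) − u DL(♯Df) + L Du(♯Df) − L² u`   at `x`.

Away from the critical points of `f` this is `K = div(∇_e e − (div e) e)` for the unit field
`e = ∇f/|∇f|` (`K dA = dω₁₂`, the pointwise step of the intrinsic proof of Gauss–Bonnet; Chern
1944, §1–§2), expressed through functions: it is the Bochner formula
`Δu = 2|Hess f|² + 2 DL(♯Df) + 2 Ric(♯Df, ♯Df)` (the tree's `IsMetricOn.lapAt_gradSqAt`) with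
`Ric(♯Df,♯Df) = ½ S u` (`ricAt_eq_half_scalAt_mul`), `Du = 2 Hess f(·, ♯Df)` and the
Cayley–Hamilton identity `normSqAt_identity_two`.
[cite: Topping2006, proof of Prop. 8.2.6 (Bochner formula)] [cite: Chern1944, §1, formula (9) (`Ω = dΠ` on the unit sphere bundle; surfaces: `K dA = dω₁₂`)] -/
theorem half_scalAt_mul_gradSqAt_sq (hG : IsMetricOn G V) (hx : x ∈ V)
    (hpos : ∀ v, v ≠ 0 → 0 < G x v v) (h2 : finrank ℝ E = 2) {f : E → ℝ}
    (hf : ContDiffOn ℝ ∞ f V) :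
    scalAt G x / 2 * gradSqAt G f x ^ 2 =
      2⁻¹ * gradSqAt G f x * lapAt G (gradSqAt G f) x
        - 2⁻¹ * fderiv ℝ (gradSqAt G f) x (sharpAt G x (fderiv ℝ (gradSqAt G f) x))
        - gradSqAt G f x * fderiv ℝ (lapAt G f) x (sharpAt G x (fderiv ℝ f x))
        + lapAt G f x * fderiv ℝ (gradSqAt G f) x (sharpAt G x (fderiv ℝ f x))
        - lapAt G f x ^ 2 * gradSqAt G f x := by
  obtain ⟨e, he⟩ := exists_orthonormal_basis_two (hG.symm x hx) hpos h2
  have hi := hG.isInvertible x hx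
  have hs := hG.symm x hx
  set H := hessAt G f x with hH
  set v := sharpAt G x (fderiv ℝ f x) with hv
  have hHs : ∀ a b, H a b = H b a :=
    hG.hessAt_comm hx (contDiffAt_of_contDiffOn hG.isOpen hf hx)
  have hflip : H.flip = H := by
    ext a b
    exact hHs b a
  -- `u = G(v, v)`
  have hu : gradSqAt G f x = G x v v := by
    rw [gradSqAt_apply, ← hv, apply_sharpAt_apply hi]
  -- `Du = 2 H(·, v)`
  have hDu : fderiv ℝ (gradSqAt G f) x = (2 : ℝ) • H.flip v :=
    (hG.hasFDerivAt_gradSqAt hx hf).fderiv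
  have hDu_v : fderiv ℝ (gradSqAt G f) x v = 2 * H v v := by
    rw [hDu, _root_.smul_apply, flip_apply, smul_eq_mul]
  have hDuDu : fderiv ℝ (gradSqAt G f) x (sharpAt G x (fderiv ℝ (gradSqAt G f) x)) =
      4 * H (sharpAt G x (H v)) v := by
    rw [hDu, hflip, map_smul, _root_.smul_apply, map_smul, smul_smul, smul_eq_mul, hHs v]
    ring
  -- Bochner, `Ric = ½ S g`, Cayley–Hamilton
  have hB := hG.lapAt_gradSqAt hx hf
  have hR := ricAt_eq_half_scalAt_mul hG hx hpos h2 v v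
  have hCH := normSqAt_identity_two e he hG hx hHs v
  rw [← hH] at hB
  rw [hDuDu, hDu_v, hB, hR, ← hu]
  set u := gradSqAt G f x
  set Lv := fderiv ℝ (lapAt G f) x v
  set S := scalAt G x
  have hT : lapAt G f x = mtrAt G x H := rfl
  rw [← hu] at hCH
  rw [hT]
  linear_combination -hCH

end Surface

end MetricCoord

end Literature.Geometry.Lorentzian

end
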